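import Summits.HodgeConjecture.CorCM.OcticWeilMultiLeThreeHodgeOfMarkman
import Summits.HodgeConjecture.CorCM.OcticWeil13PairMumfordExample
import HarnessLib

/-!
# COR-CM — THREE `(1,3)`-types over one octic CM field: NON-VACUITY (Mumford–Pohlmann's field `F(i) ⊃ ℚ(i)`, three `(1,3)`-types
# with pairwise distinct `τ`-members, the CM curve of `ℚ(i)`) and the Hodge conjecture for every finite family of CM fourfolds over
# `F(i)` of `ℚ(i)`-signature `(1,3)` whose types take at most three values, GIVEN ONLY Markman's hyperbolic-sixfold theorem

Cell `pub-hodgecm2` (COR-CM), seat b30 gen 25 (2026-08-23); count-neutral own lane OCTIC-MULTI (geometry half), non-vacuity witness of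
the NEW reach of `CorCM/OcticWeilMultiLeThreeHodgeOfMarkman.lean` (the four-type twin of gen 21's `CorCM/OcticWeil13PairMumfordExample`).
Theorems only; no definition, no named fact of its own, no `sorry`.

* §1 `twoTransitive_mumford` — over Mumford–Pohlmann's octic CM field `K = F(i)` (`j : ℚ(i) → K`), `Aut(ℂ)` is `2`-TRANSITIVE on the
  four embeddings over any `τ : ℚ(i) → ℂ`: the CM type `Φ_P` (`|P| = 2`) has a SIMPLE realisation (`MumfordFourfold.isSimple_and_exists_
  exceptional`, realised by `cmAbelianVarietyRealised_holds`), so Dodson's theorem applies (gen 19's `OcticWeilFourfold.twoTransitive_of_isSimple`).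
* §2 `exists_hypotheses_octicWeil13Triple` — the hypotheses of the three-type theorem are INHABITED: the `(1,3)`-types `Φ'_0, Φ'_1, Φ'_2`
  read through a frame (`OcticWeilMixed.MumfordExample.exists_cmType13_of_frame`) are pairwise distinct, each with one member over `τ`,
  realised by `cmAbelianVarietyRealised_holds`; `E` a CM elliptic curve of `ℚ(i)`.
* §3 **`hodgeConjectureFor_mumfordFamily₁₃_of_markmanSixfold`** — for EVERY finite family `A_j ⊨ (F(i); Θ_j)` of CM fourfolds of
  `ℚ(i)`-signature `(1,3)` whose types take at most three values and every CM elliptic curve `E` of `ℚ(i)`: every `C` dominated by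
  `E^a × ∏_j A_j` satisfies the Hodge conjecture, GIVEN ONLY Markman's hyperbolic-sixfold theorem — NO Galois hypothesis left (it is
  discharged by §1); `hodgeConjectureFor_mumford13Triple_of_markmanSixfold` — the three frame-read types, every product of copies of
  `E, B'₀, B'₁, B'₂` (its Hodge ring contains the six EIGHTFOLD Weil classes of the `B'_l × B̄'_m`).
HONEST FRAMING: conditional on the displayed Markman binder; `HC_CM` is not asserted.
[cite: Pohlmann1968, §3] [cite: Dodson1984, §3.3.2 Theorem] [cite: Shimura1998, §6.2 Thm. 3 and §18.2 Lemma (i)]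
[cite: Markman2025SecantWeil, Thm 1.5.1]

## References
* [Pohlmann1968] H. Pohlmann, Ann. of Math. 88 (1968), §3.  [Dodson1984] B. Dodson, Trans. AMS 283 (1984), §3.3.2.  [Shimura1998]
  G. Shimura, *Abelian varieties with CM and modular functions*, §6.2 Thm. 3, §18.2 Lemma (i).  [Markman2025SecantWeil] E. Markman,
  arXiv:2502.03415 (unrefereed), Thm 1.5.1.  [MumfordAV1970] D. Mumford, *Abelian Varieties*, §19.
-/

noncomputable section

open CategoryTheory CategoryTheory.Limits NumberField

namespace Summit.HodgeConjecture.CorCM.OcticWeilMulti.MumfordExample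

open Literature.AlgebraicGeometry Literature.AlgebraicGeometry.Motives Literature.AlgebraicGeometry.HodgeTheory
open Literature.AlgebraicGeometry.ComplexMultiplication (IsCMTypeRealisation)
open Literature.AlgebraicTopology.SingularHomology
open Literature.AlgebraicGeometry.Pohlmann1968.MumfordFourfold (K Qi j weilType finrank_K isSimple_and_exists_exceptional)
open Literature.NumberTheory.NumberFields.MumfordQuartic (F)
open Literature.NumberTheory.ComplexMultiplication (CMTypeCount.single CMTypeCount.single_val)
open Summit.HodgeConjecture.CorCM.Census.OcticWeilMixed (signTabM)
open Summit.HodgeConjecture.CorCM.OcticWeilFourfold (exists_frame₂ twoTransitive_of_isSimple)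
open Summit.HodgeConjecture.CorCM.OcticWeilFourfold.MumfordExample (isCMField_Qi finrank_Qi card_filter_comp_j_eq_two)
open Summit.HodgeConjecture.CorCM.OcticWeilMixed.MumfordExample (exists_cmType13_of_frame count_of_frame13)
open Summit.HodgeConjecture.CorCM.OcticWeil13Pair.MumfordExample (symm_mem_iff_of_frame13)
open Summit.HodgeConjecture.CorCM.Domination (AVDominatedBy)

open scoped Classical

/-! ## §1 `2`-transitivity over Mumford–Pohlmann's field -/

/-- **Over Mumford–Pohlmann's octic CM field `K = F(i) ⊃ ℚ(i)`, `Aut(ℂ)` is `2`-TRANSITIVE on the four embeddings over any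
`τ : ℚ(i) → ℂ`**: the `(2,2)`-type `Φ_P` (`|P| = 2`) has a SIMPLE realisation, and Dodson's theorem applies.
[cite: Pohlmann1968, §3] [cite: Dodson1984, §3.3.2 Theorem] [cite: Shimura1998, §6.2 Thm. 3] -/
theorem twoTransitive_mumford (τ : Qi →+* ℂ) :
    ∀ s t s' t' : K →+* ℂ, s.comp j = τ → t.comp j = τ → s'.comp j = τ → t'.comp j = τ → s ≠ t → s' ≠ t' →
      ∃ ρ : ℂ ≃+* ℂ, (ρ : ℂ →+* ℂ).comp s = s' ∧ (ρ : ℂ →+* ℂ).comp t = t' := by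
  haveI : IsCMField Qi := isCMField_Qi
  obtain ⟨P, -, hP⟩ := Finset.exists_subset_card_eq (s := (Finset.univ : Finset (F →+* ℂ))) (n := 2)
    (by rw [Finset.card_univ, Literature.NumberTheory.NumberFields.MumfordQuartic.card_embeddings]; norm_num)
  obtain ⟨B, ιB, θB, hB⟩ := cmAbelianVarietyRealised_holds K (weilType P)
  exact twoTransitive_of_isSimple finrank_K finrank_Qi j hB (isSimple_and_exists_exceptional hP hB).1 τ (card_filter_comp_j_eq_two hP τ)

/-! ## §2 Non-vacuity of the three-type hypotheses -/

variable {L : Type} [Field L] {e : (L →+* ℂ) ≃ Fin 4 × Bool}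

/-- Frame-read `(1,3)`-types at distinct positions are distinct. [folklore] -/
theorem ne_of_frame13 {c c' : Fin 4} (hcc : c ≠ c') {Φ Φ' : CMType L}
    (hΦ : ∀ s, s ∈ Φ.1 ↔ (e s).2 = signTabM c 0 2 (e s).1) (hΦ' : ∀ s, s ∈ Φ'.1 ↔ (e s).2 = signTabM c' 0 2 (e s).1) : Φ ≠ Φ' := by
  intro h
  have h1 : e.symm (c, true) ∈ Φ.1 := (symm_mem_iff_of_frame13 hΦ c).2 rfl
  rw [h] at h1
  exact hcc ((symm_mem_iff_of_frame13 hΦ' c).1 h1)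

/-- **NON-VACUITY.**  There exist a CM field `K` of degree `8`, an imaginary quadratic `k` with `i : k → K`, `τ : k → ℂ`, THREE pairwise
distinct CM types `Φ'₀, Φ'₁, Φ'₂` of `K` of `k`-signature `(1,3)` with realisations, a CM elliptic curve `E ⊨ (k; Ψ ∋ τ)`, and `Aut(ℂ)`
`2`-transitive on the four embeddings of `K` over `τ` — Mumford–Pohlmann's `F(i) ⊃ ℚ(i)`, the types read at positions `0, 1, 2` of a
frame, all realised by `cmAbelianVarietyRealised_holds`. [cite: Pohlmann1968, §3] [cite: Shimura1998, §6.2 Thm. 3] [cite: Dodson1984, §3.3.2 Theorem] -/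
theorem exists_hypotheses_octicWeil13Triple :
    ∃ (K k : Type) (_ : Field K) (_ : NumberField K) (_ : IsCMField K) (_ : Field k) (_ : NumberField k) (_ : IsCMField k)
      (i : k →+* K) (τ : k →+* ℂ) (Φ' : Fin 3 → CMType K) (B' : Fin 3 → AbelianVariety ℂ)
      (ι' : ∀ l, 𝓞 K →+* End (B' l)) (θ' : ∀ l, K →+* Module.End ℂ (complexBetti (B' l).X 1))
      (Ψ : CMType k) (E : AbelianVariety ℂ) (ιE : 𝓞 k →+* End E) (θE : k →+* Module.End ℂ (complexBetti E.X 1)),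
      Module.finrank ℚ K = 8 ∧ Module.finrank ℚ k = 2 ∧ (∀ l, IsCMTypeRealisation (Φ' l) (B' l) (ι' l) (θ' l)) ∧
      Function.Injective Φ' ∧ IsCMTypeRealisation Ψ E ιE θE ∧ τ ∈ Ψ.1 ∧
      (∀ l, (Finset.univ.filter fun s : K →+* ℂ => s.comp i = τ ∧ s ∈ (Φ' l).1).card = 1) ∧
      ∀ s t s' t' : K →+* ℂ, s.comp i = τ → t.comp i = τ → s'.comp i = τ → t'.comp i = τ → s ≠ t → s' ≠ t' →
        ∃ ρ : ℂ ≃+* ℂ, (ρ : ℂ →+* ℂ).comp s = s' ∧ (ρ : ℂ →+* ℂ).comp t = t' := by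
  haveI : IsCMField Qi := isCMField_Qi
  obtain ⟨P, -, hP⟩ := Finset.exists_subset_card_eq (s := (Finset.univ : Finset (F →+* ℂ))) (n := 2)
    (by rw [Finset.card_univ, Literature.NumberTheory.NumberFields.MumfordQuartic.card_embeddings]; norm_num)
  obtain ⟨τ⟩ : Nonempty (Qi →+* ℂ) := inferInstance
  obtain ⟨E, ιE, θE, hE⟩ := cmAbelianVarietyRealised_holds Qi (CMTypeCount.single finrank_Qi τ)
  have hττ : ComplexEmbedding.conjugate τ ≠ τ := QuarticCM.conjugate_ne τ
  have hk : ∀ σ : Qi →+* ℂ, σ = τ ∨ σ = ComplexEmbedding.conjugate τ := fun σ =>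
    QuarticCM.eq_or_eq_conjugate_of_quadratic finrank_Qi τ σ
  obtain ⟨e, he_sign, he_conj, -⟩ := exists_frame₂ finrank_K finrank_Qi j hττ hk (weilType P) (card_filter_comp_j_eq_two hP τ)
  -- the three `(1,3)`-types at positions `0, 1, 2`
  have hty : ∀ l : Fin 3, ∃ Φ : CMType K, ∀ s, s ∈ Φ.1 ↔ (e s).2 = signTabM (Fin.castSucc l) 0 2 (e s).1 :=
    fun l => exists_cmType13_of_frame he_conj (Fin.castSucc l)
  choose Φ' hΦ' using hty
  have hreal : ∀ l : Fin 3, ∃ (B : AbelianVariety ℂ) (ιB : 𝓞 K →+* End B) (θB : K →+* Module.End ℂ (complexBetti B.X 1)),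
      IsCMTypeRealisation (Φ' l) B ιB θB := fun l => cmAbelianVarietyRealised_holds K (Φ' l)
  choose B' ι' θ' hB' using hreal
  refine ⟨K, Qi, inferInstance, inferInstance, inferInstance, inferInstance, inferInstance, inferInstance, j, τ, Φ', B', ι', θ',
    CMTypeCount.single finrank_Qi τ, E, ιE, θE, finrank_K, finrank_Qi, hB', fun l l' h => ?_, hE,
    by rw [CMTypeCount.single_val]; rfl, fun l => count_of_frame13 he_sign (hΦ' l), twoTransitive_mumford τ⟩
  by_contra hll
  exact ne_of_frame13 (fun h' => hll (Fin.castSucc_injective _ h')) (hΦ' l) (hΦ' l') h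

/-! ## §3 The Hodge conjecture over Mumford–Pohlmann's field, no Galois hypothesis left -/

section Family

variable {n : ℕ} {Θ : Fin n → CMType K} {A : Fin n → AbelianVariety ℂ} {ι : ∀ l, 𝓞 K →+* End (A l)}
  {θ : ∀ l, K →+* Module.End ℂ (complexBetti (A l).X 1)}
  {Ψ : CMType Qi} {E : AbelianVariety ℂ} {ιE : 𝓞 Qi →+* End E} {θE : Qi →+* Module.End ℂ (complexBetti E.X 1)}

/-- **FAMILIES OF `(1,3)`-FOURFOLDS OVER MUMFORD–POHLMANN'S FIELD.**  `K = F(i) ⊃ ℚ(i)` (`j`), `τ : ℚ(i) → ℂ`; `A_l ⊨ (K; Θ_l)` (`l < n`) CM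
abelian fourfolds of `ℚ(i)`-signature `(1,3)` whose types all lie in `{Θ_{l₁}, Θ_{l₂}, Θ_{l₃}}`; `E ⊨ (ℚ(i); Ψ ∋ τ)` a CM elliptic curve:
every `C` dominated by `E^a × ∏_l A_l` satisfies the Hodge conjecture, GIVEN ONLY Markman's hyperbolic-sixfold theorem — the
`2`-transitivity is discharged by `twoTransitive_mumford`. [cite: Markman2025SecantWeil, Thm 1.5.1] [cite: Pohlmann1968, §3]
[cite: Dodson1984, §3.3.2 Theorem] [cite: MumfordAV1970, §19] -/
theorem hodgeConjectureFor_mumfordFamily₁₃_of_markmanSixfold (hM6 : Markman2025_weilClasses_algebraic_hyperbolicSixfold)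
    (hA : ∀ l, IsCMTypeRealisation (Θ l) (A l) (ι l) (θ l)) {τ : Qi →+* ℂ} (l₁ l₂ l₃ : Fin n)
    (h13 : ∀ l, (Finset.univ.filter fun s : K →+* ℂ => s.comp j = τ ∧ s ∈ (Θ l).1).card = 1)
    (hpos : ∀ l, Θ l = Θ l₁ ∨ Θ l = Θ l₂ ∨ Θ l = Θ l₃)
    (hE : IsCMTypeRealisation Ψ E ιE θE) (hτΨ : τ ∈ Ψ.1) (a : ℕ)
    {C : AbelianVariety ℂ} (hC : AVDominatedBy C ((⨁ fun _ : Fin a => E).prod (⨁ A))) :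
    HodgeConjectureFor C.dim C.X := by
  haveI : IsCMField Qi := isCMField_Qi
  exact hodgeConjectureFor_of_avDominatedBy_family₁₃_le₃_of_markmanSixfold hM6 finrank_K finrank_Qi j hA l₁ l₂ l₃ h13 hpos
    (twoTransitive_mumford τ) hE hτΨ a hC

/-- **THE THREE FRAME-READ `(1,3)`-TYPES: the Hodge conjecture for every product of copies of `E, B'₀, B'₁, B'₂`, GIVEN ONLY Markman's
hyperbolic-sixfold theorem**, where `B'_c ⊨ (F(i); Φ'_c)` realise the `(1,3)`-types at positions `c = 0, 1, 2` of a frame `e` over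
`(j, τ)` and `E` is a CM elliptic curve of `ℚ(i)` — the Hodge rings contain the six EIGHTFOLD Weil classes of the `B'_l × B̄'_m`.
[cite: Markman2025SecantWeil, Thm 1.5.1] [cite: Pohlmann1968, §3] -/
theorem hodgeConjectureFor_mumford13Triple_of_markmanSixfold (hM6 : Markman2025_weilClasses_algebraic_hyperbolicSixfold)
    {N : ℕ} {τ : Qi →+* ℂ} {e : (K →+* ℂ) ≃ Fin 4 × Bool} (he_sign : ∀ s, (e s).2 = true ↔ s.comp j = τ)
    {Φ' : Fin 3 → CMType K} (hr : ∀ (c : Fin 3) (s : K →+* ℂ), s ∈ (Φ' c).1 ↔ (e s).2 = signTabM (Fin.castSucc c) 0 2 (e s).1)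
    {B' : Fin 3 → AbelianVariety ℂ} {ι' : ∀ c, 𝓞 K →+* End (B' c)} {θ' : ∀ c, K →+* Module.End ℂ (complexBetti (B' c).X 1)}
    (hB' : ∀ c, IsCMTypeRealisation (Φ' c) (B' c) (ι' c) (θ' c))
    (hE : IsCMTypeRealisation Ψ E ιE θE) (hτΨ : τ ∈ Ψ.1) (κ : Fin N → Fin 4) :
    HodgeConjectureFor (⨁ fun m => (Fin.cons E B' : Fin 4 → AbelianVariety ℂ) (κ m)).dim
      (⨁ fun m => (Fin.cons E B' : Fin 4 → AbelianVariety ℂ) (κ m)).X := by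
  haveI : IsCMField Qi := isCMField_Qi
  have hττ : ComplexEmbedding.conjugate τ ≠ τ := QuarticCM.conjugate_ne τ
  have hk : ∀ σ : Qi →+* ℂ, σ = τ ∨ σ = ComplexEmbedding.conjugate τ := fun σ =>
    QuarticCM.eq_or_eq_conjugate_of_quadratic finrank_Qi τ σ
  have h13 : ∀ c, (Finset.univ.filter fun s : K →+* ℂ => s.comp j = τ ∧ s ∈ (Φ' c).1).card = 1 :=
    fun c => count_of_frame13 he_sign (hr c)
  have hinj : Function.Injective Φ' := fun c c' h => by
    by_contra hcc
    exact ne_of_frame13 (fun h' => hcc (Fin.castSucc_injective _ h')) (hr c) (hr c') h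
  exact hodgeConjectureFor_biproduct_comp_cons_of_markman_indepO finrank_K finrank_Qi j hB' hE hτΨ
    (fun c hc => by rw [h13 c] at hc; exact absurd hc (by norm_num)) (fun _ _ => hM6) (fun c => Or.inl (h13 c))
    (hIndO_of_typeCount_one le_rfl finrank_K finrank_Qi j hττ hk Φ' h13 hinj) (twoTransitive_mumford τ) κ

end Family

end Summit.HodgeConjecture.CorCM.OcticWeilMulti.MumfordExample

end
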